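import Summits.RiemannHypothesis.RiemannHypothesis.Theses.NbSectionZeroLaw
import Summits.RiemannHypothesis.RiemannHypothesis.Theorems.NbSectionZeroLawStepSpace
import HarnessLib

/-!
# Route NbSectionZeroLaw — crux `IntrinsicDualBound` (stmt-RiemannHypothesis-23096)

WEAK DUALITY IN THE STEP SPACE.  For every section `ζ_M`, every Dirichlet polynomial
`A_a(s) = Σ_{j<N} a_j (j+1)^{-s}`, every finite family of zeros `ρ_i` of `ζ_M` with `Re ρ_i > 1/2`
and weights `x_i`:

  `ofReal( 2π ‖Σ_i conj(x_i)/ρ_i‖² / Re Σ_{i,j} x_i conj(x_j) G(ρ_i,ρ_j) ) ≤ ∫⁻ ‖1 − ζ_M A_a‖² dt/(1/4+t²)`,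

`G(ρ,ρ') = Σ_{k ≥ 1} k(k+1) conj(k^{-ρ} − (k+1)^{-ρ}) (k^{-ρ'} − (k+1)^{-ρ'}) / (conj ρ · ρ')` the Gram
kernel of the point evaluations of the step space `S ≅ ℓ²(w)`, `w_k = 1/(k(k+1))`.

Proof (this file, on top of `Theorems/NbSectionZeroLawStepSpace.lean`): write
`D = 1 − ζ_M A_a = Σ_{n ≤ L} c_n n^{-s}` with partial sums `S_k`; the step isometry gives
`∫ |D|²/(1/4+t²) = 2π Σ_k w_k |S_k|² =: 2π W`; the evaluation identity gives, at each zero,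
`1/ρ_i = D(ρ_i)/ρ_i = Σ_k S_k e_i(k)` with `e_i(k) = (k^{-ρ_i} − (k+1)^{-ρ_i})/ρ_i`, hence
`P := Σ conj(x_i)/ρ_i = Σ_k S_k E(k)`, `E = Σ conj(x_i) e_i`; Cauchy–Schwarz in `ℓ²(w)`
(`Real.inner_le_Lp_mul_Lq_tsum_of_nonneg`, `p = q = 2`) gives `|P|² ≤ W · Σ_k |E(k)|²/w_k`, and
`Σ_k |E(k)|²/w_k = Σ_{i,j} x_i conj(x_j) G_{ij}` termwise (`G_{ij} = Σ_k conj(e_i(k)) e_j(k)/w_k`).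
A nonpositive denominator makes the left side `0`.

RH-free; no definitions; standard axioms.  References: N. Nikolski, Ann. Inst. Fourier 45 (1995)
(distance formulae via reproducing kernels); J.-F. Burnol, Adv. Math. 170 (2002) (lower bounds by
evaluation at zeros); A. Ghosh, K. Kremnitzer, W. Noor, C. F. Santos (the space `ℓ²_ω`).
No summit is proved by this file; nothing here bears on the truth of RH.
-/

noncomputable section

-- D-0017: `Summit.<S>.<S>.…` is the designed namespace of a single-problem summit.
set_option linter.dupNamespace false

open scoped Real ComplexConjugate Topology
open MeasureTheory Complex Finset Filter

namespace Summit.RiemannHypothesis.RiemannHypothesis.Theorems.NbSectionZeroLaw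

open Literature.Barriers.RiemannHypothesis

/-! ## §1 — The Gram kernel: summability and the quadratic form -/

/-- Size of one Gram term: for `Re ρ, Re ρ' > 0`,
`‖(m+1)(m+2) conj(u_ρ(m)) u_{ρ'}(m) / (conj ρ · ρ')‖ ≤ 2 (m+1)^{-(Re ρ + Re ρ')}`,
`u_ρ(m) = (m+1)^{-ρ} − (m+2)^{-ρ}`. [folklore] -/
theorem norm_gram_term_le {ρ ρ' : ℂ} (hρ : 0 < ρ.re) (hρ' : 0 < ρ'.re) (m : ℕ) :
    ‖((m : ℂ) + 1) * ((m : ℂ) + 2) * conj (((m : ℂ) + 1) ^ (-ρ) - ((m : ℂ) + 2) ^ (-ρ)) *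
        (((m : ℂ) + 1) ^ (-ρ') - ((m : ℂ) + 2) ^ (-ρ')) / (conj ρ * ρ')‖ ≤
      2 * ((m : ℝ) + 1) ^ (-(ρ.re + ρ'.re)) := by
  have hm : (0 : ℝ) < (m : ℝ) + 1 := by positivity
  have hρ0 : ρ ≠ 0 := fun h ↦ by rw [h] at hρ; simp at hρ
  have hρ0' : ρ' ≠ 0 := fun h ↦ by rw [h] at hρ'; simp at hρ'
  have hnρ : 0 < ‖ρ‖ := norm_pos_iff.mpr hρ0
  have hnρ' : 0 < ‖ρ'‖ := norm_pos_iff.mpr hρ0'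
  have hu := norm_cpow_succ_sub_le m hρ
  have hu' := norm_cpow_succ_sub_le m hρ'
  have h1 : ‖((m : ℂ) + 1)‖ = (m : ℝ) + 1 := by
    rw [show ((m : ℂ) + 1) = (((m : ℝ) + 1 : ℝ) : ℂ) by push_cast; ring, Complex.norm_real,
      Real.norm_of_nonneg hm.le]
  have h2 : ‖((m : ℂ) + 2)‖ = (m : ℝ) + 2 := by
    rw [show ((m : ℂ) + 2) = (((m : ℝ) + 2 : ℝ) : ℂ) by push_cast; ring, Complex.norm_real,
      Real.norm_of_nonneg (by positivity)]
  rw [norm_div, norm_mul, norm_mul, norm_mul, Complex.norm_conj, h1, h2, norm_mul,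
    Complex.norm_conj, div_le_iff₀ (by positivity)]
  -- `(m+1)(m+2) ‖u‖ ‖u'‖ ≤ 2 (m+1)^{-(σ+σ')} ‖ρ‖ ‖ρ'‖`
  have hpow : ((m : ℝ) + 1) * ((m : ℝ) + 1) * (((m : ℝ) + 1) ^ (-ρ.re - 1) *
      ((m : ℝ) + 1) ^ (-ρ'.re - 1)) = ((m : ℝ) + 1) ^ (-(ρ.re + ρ'.re)) := by
    rw [← Real.rpow_add hm, show -ρ.re - 1 + (-ρ'.re - 1) = -(ρ.re + ρ'.re) + (-2 : ℝ) by ring,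
      Real.rpow_add hm, show (-2 : ℝ) = ((-2 : ℤ) : ℝ) by norm_num, Real.rpow_intCast]
    field_simp
  calc ((m : ℝ) + 1) * ((m : ℝ) + 2) * ‖((m : ℂ) + 1) ^ (-ρ) - ((m : ℂ) + 2) ^ (-ρ)‖ *
        ‖((m : ℂ) + 1) ^ (-ρ') - ((m : ℂ) + 2) ^ (-ρ')‖
      ≤ ((m : ℝ) + 1) * (2 * ((m : ℝ) + 1)) * (‖ρ‖ * ((m : ℝ) + 1) ^ (-ρ.re - 1)) *
          (‖ρ'‖ * ((m : ℝ) + 1) ^ (-ρ'.re - 1)) := by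
        gcongr
        linarith
    _ = 2 * (((m : ℝ) + 1) * ((m : ℝ) + 1) * (((m : ℝ) + 1) ^ (-ρ.re - 1) *
          ((m : ℝ) + 1) ^ (-ρ'.re - 1))) * (‖ρ‖ * ‖ρ'‖) := by ring
    _ = 2 * ((m : ℝ) + 1) ^ (-(ρ.re + ρ'.re)) * (‖ρ‖ * ‖ρ'‖) := by rw [hpow]

/-- The Gram terms are summable when `Re ρ + Re ρ' > 1` (in particular for two zeros right of the
critical line). [folklore] -/
theorem summable_gram_term {ρ ρ' : ℂ} (hρ : 0 < ρ.re) (hρ' : 0 < ρ'.re) (h : 1 < ρ.re + ρ'.re) :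
    Summable fun m : ℕ ↦ ((m : ℂ) + 1) * ((m : ℂ) + 2) *
      conj (((m : ℂ) + 1) ^ (-ρ) - ((m : ℂ) + 2) ^ (-ρ)) *
        (((m : ℂ) + 1) ^ (-ρ') - ((m : ℂ) + 2) ^ (-ρ')) / (conj ρ * ρ') := by
  refine Summable.of_norm_bounded ((summable_nat_add_one_rpow_neg h).mul_left 2) fun m ↦ ?_
  exact norm_gram_term_le hρ hρ' m

/-- **The Gram quadratic form is a sum of squares.** For zeros-or-not `ρ_i` with `Re ρ_i > 1/2` and
weights `x_i`: with `E(m) = Σ_i conj(x_i) u_i(m)/ρ_i`,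
`HasSum (m ↦ (m+1)(m+2) ‖E(m)‖²) (Σ_{i,j} x_i conj(x_j) G_{ij})` (as complex numbers). [folklore] -/
theorem hasSum_gram_form {k : ℕ} (ρ x : Fin k → ℂ) (hρ : ∀ i, 1 / 2 < (ρ i).re) :
    HasSum (fun m : ℕ ↦ ((((m : ℝ) + 1) * ((m : ℝ) + 2) *
        ‖∑ i, conj (x i) * ((((m : ℂ) + 1) ^ (-ρ i) - ((m : ℂ) + 2) ^ (-ρ i)) / ρ i)‖ ^ 2 : ℝ) : ℂ))
      (∑ i, ∑ j, x i * conj (x j) * ∑' m : ℕ, ((m : ℂ) + 1) * ((m : ℂ) + 2) *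
        conj (((m : ℂ) + 1) ^ (-ρ i) - ((m : ℂ) + 2) ^ (-ρ i)) *
          (((m : ℂ) + 1) ^ (-ρ j) - ((m : ℂ) + 2) ^ (-ρ j)) / (conj (ρ i) * ρ j)) := by
  have hpos : ∀ i, 0 < (ρ i).re := fun i ↦ by linarith [hρ i]
  have hne : ∀ i, ρ i ≠ 0 := fun i h ↦ by have := hpos i; rw [h] at this; simp at this
  -- each (i,j) entry
  have hij : ∀ i j, HasSum (fun m : ℕ ↦ x i * conj (x j) * (((m : ℂ) + 1) * ((m : ℂ) + 2) *
      conj (((m : ℂ) + 1) ^ (-ρ i) - ((m : ℂ) + 2) ^ (-ρ i)) *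
        (((m : ℂ) + 1) ^ (-ρ j) - ((m : ℂ) + 2) ^ (-ρ j)) / (conj (ρ i) * ρ j)))
      (x i * conj (x j) * ∑' m : ℕ, ((m : ℂ) + 1) * ((m : ℂ) + 2) *
        conj (((m : ℂ) + 1) ^ (-ρ i) - ((m : ℂ) + 2) ^ (-ρ i)) *
          (((m : ℂ) + 1) ^ (-ρ j) - ((m : ℂ) + 2) ^ (-ρ j)) / (conj (ρ i) * ρ j)) :=
    fun i j ↦ ((summable_gram_term (hpos i) (hpos j) (by linarith [hρ i, hρ j])).hasSum).mul_left _
  have hsum := hasSum_sum fun i (_ : i ∈ Finset.univ) ↦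
    hasSum_sum fun j (_ : j ∈ Finset.univ) ↦ hij i j
  refine hsum.congr_fun fun m ↦ ?_
  -- the termwise identity `Σ_{i,j} x_i x̄_j T_{ij}(m) = (m+1)(m+2) ‖E(m)‖²`
  set E : ℂ := ∑ i, conj (x i) * ((((m : ℂ) + 1) ^ (-ρ i) - ((m : ℂ) + 2) ^ (-ρ i)) / ρ i)
    with hE
  have hconjE : conj E = ∑ i, x i * (conj (((m : ℂ) + 1) ^ (-ρ i) - ((m : ℂ) + 2) ^ (-ρ i)) /
      conj (ρ i)) := by
    rw [hE, map_sum]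
    refine Finset.sum_congr rfl fun i _ ↦ ?_
    rw [map_mul, map_div₀, Complex.conj_conj]
  have hnorm : ((‖E‖ ^ 2 : ℝ) : ℂ) = conj E * E := by
    rw [RCLike.conj_mul]; push_cast; rfl
  calc ((((m : ℝ) + 1) * ((m : ℝ) + 2) * ‖E‖ ^ 2 : ℝ) : ℂ)
      = ((m : ℂ) + 1) * ((m : ℂ) + 2) * (conj E * E) := by rw [← hnorm]; push_cast; ring
    _ = ((m : ℂ) + 1) * ((m : ℂ) + 2) * ((∑ i, x i * (conj (((m : ℂ) + 1) ^ (-ρ i) -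
          ((m : ℂ) + 2) ^ (-ρ i)) / conj (ρ i))) *
          ∑ j, conj (x j) * ((((m : ℂ) + 1) ^ (-ρ j) - ((m : ℂ) + 2) ^ (-ρ j)) / ρ j)) := by
        rw [hconjE]
    _ = ∑ i, ∑ j, x i * conj (x j) * (((m : ℂ) + 1) * ((m : ℂ) + 2) *
          conj (((m : ℂ) + 1) ^ (-ρ i) - ((m : ℂ) + 2) ^ (-ρ i)) *
            (((m : ℂ) + 1) ^ (-ρ j) - ((m : ℂ) + 2) ^ (-ρ j)) / (conj (ρ i) * ρ j)) := by
        rw [Finset.sum_mul_sum, Finset.mul_sum]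
        refine Finset.sum_congr rfl fun i _ ↦ ?_
        rw [Finset.mul_sum]
        refine Finset.sum_congr rfl fun j _ ↦ ?_
        have hi : conj (ρ i) ≠ 0 := by
          rw [map_ne_zero_iff _ (RingHom.injective _)]; exact hne i
        have hj : ρ j ≠ 0 := hne j
        field_simp

/-! ## §2 — The main theorem -/

/-- **INTRINSIC DUAL BOUND (weak duality in the step space).** For all `M, N, a`, every finite family
of zeros `ρ_i` of `ζ_M` with `Re ρ_i > 1/2` and weights `x_i`,
`ofReal(2π ‖Σ conj(x_i)/ρ_i‖² / Re Q(x,ρ)) ≤ ∫⁻ ‖1 − ζ_M A_a‖² dt/(1/4+t²)`,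
`Q(x,ρ) = Σ_{i,j} x_i conj(x_j) G(ρ_i,ρ_j)` with the step-space Gram kernel `G`.
[cite: Nikolski1995, Thm 0.1 (distance formula via reproducing kernels)]
[cite: Burnol2002, Thm 1.3 (lower bounds by evaluation at zeros)] -/
theorem intrinsicDualBound (M N : ℕ) (a : Fin N → ℂ) (k : ℕ) (ρ x : Fin k → ℂ)
    (hρ : ∀ i, zetaPartialSum M (ρ i) = 0 ∧ 1 / 2 < (ρ i).re) :
    ENNReal.ofReal (2 * Real.pi * ‖∑ i, (starRingEnd ℂ) (x i) / ρ i‖ ^ 2 /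
        (∑ i, ∑ j, x i * (starRingEnd ℂ) (x j) * ∑' m : ℕ, ((m : ℂ) + 1) * ((m : ℂ) + 2) *
          (starRingEnd ℂ) (((m : ℂ) + 1) ^ (-ρ i) - ((m : ℂ) + 2) ^ (-ρ i)) *
            (((m : ℂ) + 1) ^ (-ρ j) - ((m : ℂ) + 2) ^ (-ρ j)) / ((starRingEnd ℂ) (ρ i) * ρ j)).re) ≤
      ∫⁻ t : ℝ, ENNReal.ofReal (‖1 - zetaPartialSum M (1 / 2 + t * Complex.I) *
        ∑ n : Fin N, a n * ((n : ℂ) + 1) ^ (-(1 / 2 + t * Complex.I))‖ ^ 2 / (1 / 4 + t ^ 2)) := by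
  have hpos : ∀ i, 0 < (ρ i).re := fun i ↦ by linarith [(hρ i).2]
  have hne : ∀ i, ρ i ≠ 0 := fun i h ↦ by have := hpos i; rw [h] at this; simp at this
  -- the coefficients of `D = 1 − ζ_M A_a`
  set L : ℕ := M * N + 1 with hL
  have hL1 : 1 ≤ L := by omega
  set c : ℕ → ℂ := fun n ↦ (if n = 1 then (1 : ℂ) else 0) -
      ∑ m ∈ Icc 1 M, ∑ j : Fin N, (if m * ((j : ℕ) + 1) = n then a j else 0) with hc
  have hc0 : ∀ n, L < n → c n = 0 := fun n hn ↦ section_coeff_eq_zero M N a n hn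
  have hD : ∀ s : ℂ, ∑ n ∈ Icc 1 L, c n * (n : ℂ) ^ (-s) =
      1 - zetaPartialSum M s * ∑ j : Fin N, a j * ((j : ℂ) + 1) ^ (-s) :=
    fun s ↦ section_coeff_sum_cpow M N a s
  -- the three real quantities
  set W : ℝ := ∑ k ∈ Ico 1 L, ‖∑ n ∈ Icc 1 k, c n‖ ^ 2 / ((k : ℝ) * (k + 1)) +
      ‖∑ n ∈ Icc 1 L, c n‖ ^ 2 / L with hW
  set P : ℂ := ∑ i, conj (x i) / ρ i with hP
  set Gsum : ℂ := ∑ i, ∑ j, x i * conj (x j) * ∑' m : ℕ, ((m : ℂ) + 1) * ((m : ℂ) + 2) *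
      conj (((m : ℂ) + 1) ^ (-ρ i) - ((m : ℂ) + 2) ^ (-ρ i)) *
        (((m : ℂ) + 1) ^ (-ρ j) - ((m : ℂ) + 2) ^ (-ρ j)) / (conj (ρ i) * ρ j) with hG
  -- the integral is `2π W`
  have hI : ∫⁻ t : ℝ, ENNReal.ofReal (‖1 - zetaPartialSum M (1 / 2 + t * Complex.I) *
      ∑ n : Fin N, a n * ((n : ℂ) + 1) ^ (-(1 / 2 + t * Complex.I))‖ ^ 2 / (1 / 4 + t ^ 2)) =
      ENNReal.ofReal (2 * π * W) := by
    rw [← step_isometry_lintegral L c]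
    refine lintegral_congr fun t ↦ ?_
    rw [hD]
  rw [hI]
  -- the step-space vectors: `Sm m = S_{m+1}`, `E m = Σ_i conj(x_i) u_i(m)/ρ_i`
  set Sm : ℕ → ℂ := fun m ↦ ∑ n ∈ Icc 1 (m + 1), c n with hSm
  set E : ℕ → ℂ := fun m ↦ ∑ i, conj (x i) *
      ((((m : ℂ) + 1) ^ (-ρ i) - ((m : ℂ) + 2) ^ (-ρ i)) / ρ i) with hE
  -- (1) `P = Σ_m Sm(m) E(m)`
  have hPsum : HasSum (fun m : ℕ ↦ Sm m * E m) P := by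
    have hi : ∀ i ∈ Finset.univ, HasSum (fun m : ℕ ↦ conj (x i) * ((Sm m *
        (((m : ℂ) + 1) ^ (-ρ i) - ((m : ℂ) + 2) ^ (-ρ i))) / ρ i)) (conj (x i) / ρ i) := by
      intro i _
      have h := hasSum_eval hc0 (hpos i)
      rw [hD (ρ i), (hρ i).1, zero_mul, sub_zero] at h
      rw [div_eq_mul_one_div]
      exact (h.div_const (ρ i)).mul_left (conj (x i))
    refine (hasSum_sum hi).congr_fun fun m ↦ ?_
    rw [hE]
    dsimp only
    rw [Finset.mul_sum]
    refine Finset.sum_congr rfl fun i _ ↦ ?_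
    ring
  -- (2) the weights and the two `ℓ²` vectors
  set f : ℕ → ℝ := fun m ↦ ‖Sm m‖ * Real.sqrt (1 / (((m : ℝ) + 1) * ((m : ℝ) + 2))) with hf
  set g : ℕ → ℝ := fun m ↦ ‖E m‖ * Real.sqrt (((m : ℝ) + 1) * ((m : ℝ) + 2)) with hg
  have hf0 : ∀ m, 0 ≤ f m := fun m ↦ by positivity
  have hg0 : ∀ m, 0 ≤ g m := fun m ↦ by positivity
  have hfg : ∀ m, f m * g m = ‖Sm m * E m‖ := by
    intro m
    have hw : (0 : ℝ) < ((m : ℝ) + 1) * ((m : ℝ) + 2) := by positivity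
    rw [hf, hg, norm_mul]
    dsimp only
    calc ‖Sm m‖ * Real.sqrt (1 / (((m : ℝ) + 1) * ((m : ℝ) + 2))) *
          (‖E m‖ * Real.sqrt (((m : ℝ) + 1) * ((m : ℝ) + 2)))
        = ‖Sm m‖ * ‖E m‖ * (Real.sqrt (1 / (((m : ℝ) + 1) * ((m : ℝ) + 2))) *
            Real.sqrt (((m : ℝ) + 1) * ((m : ℝ) + 2))) := by ring
      _ = ‖Sm m‖ * ‖E m‖ := by
          rw [← Real.sqrt_mul (by positivity), one_div, inv_mul_cancel₀ hw.ne', Real.sqrt_one,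
            mul_one]
  have hf2 : HasSum (fun m ↦ f m ^ (2 : ℝ)) W := by
    have h := hasSum_weight_norm_sq hL1 hc0
    refine h.congr_fun fun m ↦ ?_
    rw [hf, Real.rpow_two]
    dsimp only
    rw [mul_pow, Real.sq_sqrt (by positivity), hSm]
    ring
  have hg2 : HasSum (fun m ↦ ((g m ^ (2 : ℝ) : ℝ) : ℂ)) Gsum := by
    have h := hasSum_gram_form ρ x fun i ↦ (hρ i).2
    refine h.congr_fun fun m ↦ ?_
    rw [hg, Real.rpow_two]
    dsimp only
    rw [mul_pow, Real.sq_sqrt (by positivity), hE]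
    push_cast
    ring
  have hg2re : HasSum (fun m ↦ g m ^ (2 : ℝ)) Gsum.re := by
    refine (Complex.hasSum_re hg2).congr_fun fun m ↦ ?_
    exact (Complex.ofReal_re _).symm
  -- (3) Cauchy–Schwarz in `ℓ²`
  obtain ⟨hfg_summ, hCS⟩ := Real.summable_and_inner_le_Lp_mul_Lq_tsum_of_nonneg
    Real.HolderConjugate.two_two hf0 hg0 hf2.summable hg2re.summable
  rw [hf2.tsum_eq, hg2re.tsum_eq] at hCS
  have hW0 : 0 ≤ W := by rw [hW]; positivity
  have hQ0 : 0 ≤ Gsum.re := by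
    rw [← hg2re.tsum_eq]; exact tsum_nonneg fun m ↦ by positivity
  have hPle : ‖P‖ ≤ W ^ (1 / (2 : ℝ)) * Gsum.re ^ (1 / (2 : ℝ)) := by
    have h1 : ‖P‖ ≤ ∑' m, ‖Sm m * E m‖ := by
      rw [← hPsum.tsum_eq]
      exact norm_tsum_le_tsum_norm (hfg_summ.congr fun m ↦ hfg m)
    have h2 : ∑' m, ‖Sm m * E m‖ = ∑' m, f m * g m := tsum_congr fun m ↦ (hfg m).symm
    rw [h2] at h1
    exact h1.trans hCS
  have hP2 : ‖P‖ ^ 2 ≤ W * Gsum.re := by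
    have h := pow_le_pow_left₀ (norm_nonneg _) hPle 2
    rw [mul_pow, ← Real.rpow_natCast (W ^ (1 / (2 : ℝ))), ← Real.rpow_natCast (Gsum.re ^ _),
      ← Real.rpow_mul hW0, ← Real.rpow_mul hQ0] at h
    norm_num at h
    exact h
  -- (4) conclude
  refine ENNReal.ofReal_le_ofReal ?_
  rcases le_or_gt Gsum.re 0 with hQ | hQ
  · have h1 : 2 * Real.pi * ‖P‖ ^ 2 / Gsum.re ≤ 0 :=
      div_nonpos_iff.mpr (Or.inl ⟨by positivity, hQ⟩)
    have h2 : 0 ≤ 2 * π * W := by positivity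
    linarith
  · rw [div_le_iff₀ hQ]
    have := mul_le_mul_of_nonneg_left hP2 (by positivity : (0 : ℝ) ≤ 2 * Real.pi)
    linarith

/-- **Closer of item stmt-RiemannHypothesis-23096** (route `NbSectionZeroLaw`, crux r3), by name:
`IntrinsicDualBound` — weak duality in the step space, for all `M, N, a`, all finite zero
certificates `(ρ, x)` (`intrinsicDualBound`).  RH-free; no summit is proved by this; nothing here
bears on the truth of RH. [cite: Nikolski1995, Thm 0.1] -/
theorem IntrinsicDualBound_proof :
    Summit.RiemannHypothesis.RiemannHypothesis.Theses.NbSectionZeroLaw.IntrinsicDualBound := by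
  intro M N a k ρ x hρ
  exact intrinsicDualBound M N a k ρ x hρ

end Summit.RiemannHypothesis.RiemannHypothesis.Theorems.NbSectionZeroLaw

end
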